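import Summits.ValiantsHypothesis.ValiantsHypothesis.Theses.KPlusLogSqLawOctave
import Summits.ValiantsHypothesis.ValiantsHypothesis.Theorems.LacunarySymmetroidMatrixDescartesCensusTropicalKLaw
import Summits.ValiantsHypothesis.ValiantsHypothesis.Theorems.KPlusLogSqLawTropicalBPolyTowers
import Summits.ValiantsHypothesis.ValiantsHypothesis.Theorems.KPlusLogSqLawWeakLiftingWindow

/-!
# Crux `OctaveWeakLifting` (stmt-ValiantsHypothesis-24457) — line «octave-aspect» (ideator val-idea-11 g5, lens `wuc`)

HONEST FRAMING.  A proof SKELETON over the OPEN crux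
`Summit.ValiantsHypothesis.ValiantsHypothesis.Theses.KPlusLogSqLawOctave.OctaveWeakLifting` (Ω-W, ledger item
`stmt-ValiantsHypothesis-24457`, route `KPlusLogSqLawOctave`, DRAFT; `closes (hT : TropicalB) (hΩ : OctaveWeakLifting)`).  The two
`stub_*` theorems are `sorry` and NOT claimed; everything else is sorry-free.  Nothing is asserted about Ω-W, `TropicalB` (stmt-19771),
`WeakLifting` (stmt-19561), `MatrixDescartes` (stmt-18050) or VP ≠ VNP — **VP ≠ VNP is not moved by this file**; a law candidate does
not move the summit.

Write `Ω(m,K)` for the largest octave count of a real symmetric lacunary pencil of format `(m,K)` and `T(m,K)` for the signed tropical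
capacity; `L = ⌊log₂ m⌋`.  Ω-W reads: `Ω(m,K) ≤ 2^(C(K+L²))·(T(m,K)+1)`.

WHERE Ω-W HAS CONTENT (located).  By Descartes (`stub_descartesCeiling`: `Z₊+1 ≤ C(m+K−1,m)`) Ω-W is automatic when `m ≤ 2^C·K`
(aspect `≤ 2^C`: `log₂ C(m+K−1,m) ≤ K·log₂(2e·2^C)`), when `K ≤ C·L`, and for bounded `m`; its content is the window
«aspect `m/K → ∞` AND `K ≳ log m`», asymptotically.  The weakest consequence of Ω-W on the SIZE axis that the tree does not decide is
therefore the **bounded-aspect octave lifting law** `BoundedAspectOctaveLifting` (this line's RUNG, `stub_boundedAspectOctaveLifting`):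
ONE constant `C` such that for every aspect bound `A`, eventually in `K`, every format `m ≤ A·K` lifts with `C` bits per class:
`SignedRow m K n → Ω(pencil) ≤ 2^(C·K)·(n+1)`.  (Descartes gives `log₂(2e(A+1))` bits per class, growing with `A`; for `A > 2^C` the
rung is open; its negation refutes Ω-W: `not_octaveWeakLifting_of_not_boundedAspectOctaveLifting`.)  It is the octave twin of the
tropical rung `BoundedAspectRate` of `Cruxes/TropicalB/Lines/aspect_decay.lean` (same seat).

THE TRANSFER (`stub_octaveFatLifting`, load-bearing together with the route's OTHER crux `TropicalB` BY NAME).  Ω-W's tropical-row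
hypothesis blocks the padding monotonicity that collapses `TropicalB` to one regime (`…TropicalBRegimeCollapse`); but CLASS padding
(append absent slope classes: the pencil is unchanged, `octaveRootLawAt_of_le_classes`) survives, and the missing row bound at the padded
format `(m, L²)` is exactly what `TropicalB` supplies.  Hence (`OctaveWeakLifting_of`, kernel-checked):
  `TropicalB → OctaveFatLifting → OctaveWeakLifting`,   `OctaveFatLifting := ∃ C, ∀ m K n, L² ≤ K → SignedRow m K n → Ω ≤ 2^(C·K)·(n+1)`,
i.e. MODULO THE SIBLING CRUX the thin regime `K < L²` of Ω-W is dead weight for the route (`octaveFatLifting_iff_octaveWeakLifting_of_tropicalB`),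
and the fat law is the rung with the onset `K₀(A) = 4^max(⌊log₂A⌋+2, 8)` removed... more precisely the rung IS the fat law read along
bounded aspects (`boundedAspectOctaveLifting_of_octaveFatLifting`).  WHY EASIER than Ω-W: on fat formats `L ≤ √K`, so (i) every budget
is `2^(O(K))` — «`O(1)` octaves of roots per slope class, amortised» — with no `log² m` bookkeeping; (ii) the proved rungs of the octave
currency (`Octave.shallowOctaveLifting_proof`: `Ω ≤ (2(M+Δ)+3)(n+1)`, `M = m(log₂(mK)+1)`; dominated/tempered lifting) lose factors
polynomial in `m`, which are AFFORDABLE here exactly when `m ≤ 2^(O(K))`, i.e. up to exponential aspect — the fat regime contains the whole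
onset of content `2^C < m/K`, `K₀(A) ≤ K`; (iii) the kill instrument is one-parametric: bounded-aspect families `(A·K, K)`, `K → ∞`.
[folklore] padding bookkeeping; the laws are cell conjectures (no citation exists).
-/

set_option linter.dupNamespace false
set_option autoImplicit false

namespace Summit.ValiantsHypothesis.ValiantsHypothesis.Cruxes.OctaveWeakLifting.OctaveAspect

open Summit.ValiantsHypothesis.ValiantsHypothesis.Theorems.LacunarySymmetroidMatrixDescartes.TropicalCensus (TropRootLawAt)
open Summit.ValiantsHypothesis.ValiantsHypothesis.Theses.KPlusLogSqLawOctave (TropicalB OctaveWeakLifting)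
open Summit.ValiantsHypothesis.ValiantsHypothesis.Theorems.KPlusLogSqLaw.OctaveGlue (OctaveRootLawAt octaveRootLawAt_mono octaveCount_le_card)
open Summit.ValiantsHypothesis.ValiantsHypothesis.Theorems.LacunarySymmetroidMatrixDescartes (RealRootLawAt)
open Summit.ValiantsHypothesis.ValiantsHypothesis.Theorems.KPlusLogSqLaw (realRootLawAt_fatCone)
open Summit.ValiantsHypothesis.ValiantsHypothesis.Theorems.KPlusLogSqLaw (PolyTowers.sq_log_succ_le_self)
open Polynomial

/-! ## 1. Currency (verbatim the crux's hypothesis) -/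

/-- the SIGNED tropical row of format `(m, K)` is `≤ n` — verbatim the hypothesis of the route decl `OctaveWeakLifting`. -/
def SignedRow (m K n : ℕ) : Prop :=
  ∀ (d : Fin K → ℕ) (v ε : Fin m → Fin m → Fin K → ℤ) (n' : ℕ) (θ : Fin (n' + 1) → ℤ)
    (p : Fin (n' + 1) → Equiv.Perm (Fin m) × (Fin m → Fin K)),
    (∀ i j l, (ε i j l).natAbs ≤ 1) → StrictMono θ →
    (∀ k, Summit.ValiantsHypothesis.ValiantsHypothesis.Theorems.MatrixDescartes.Negative.IsDominant d v ε (θ k) (p k)) →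
    (∀ k : Fin n', Summit.ValiantsHypothesis.ValiantsHypothesis.Theorems.MatrixDescartes.Negative.termSign ε (p k.castSucc) *
      Summit.ValiantsHypothesis.ValiantsHypothesis.Theorems.MatrixDescartes.Negative.termSign ε (p k.succ) < 0) → n' ≤ n

/-- the crux, unfolded through `SignedRow` (δ). -/
theorem octaveWeakLifting_iff : OctaveWeakLifting ↔
    ∃ C : ℕ, ∀ m K n : ℕ, SignedRow m K n → OctaveRootLawAt m K (2 ^ (C * (K + Nat.log 2 m ^ 2)) * (n + 1)) := Iff.rfl

/-- `SignedRow m K n` is the tree's `TropRootLawAt m K n` (δ). -/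
theorem signedRow_iff_tropRootLawAt (m K n : ℕ) : SignedRow m K n ↔ TropRootLawAt m K n := Iff.rfl

/-- the sibling crux, unfolded (δ). -/
theorem tropicalB_iff : TropicalB ↔ ∃ C : ℕ, ∀ m K : ℕ, SignedRow m K (2 ^ (C * (K + Nat.log 2 m ^ 2))) := by
  constructor
  · rintro ⟨C, hC⟩; exact ⟨C, fun m K d v ε n' θ p hε hθ hdom halt => hC m K d v ε n' θ p hε hθ hdom halt⟩
  · rintro ⟨C, hC⟩; exact ⟨C, fun m K d v ε n' θ p hε hθ hdom halt => hC m K d v ε n' θ p hε hθ hdom halt⟩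

/-! ## 2. The two statements and the stubs (the ONLY sorries; not claimed) -/

/-- **TRANSFER — the FAT octave lifting law**: Ω-W on the fat regime `⌊log₂ m⌋² ≤ K`, budget `2^(C·K)·(n+1)`. -/
def OctaveFatLifting : Prop :=
  ∃ C : ℕ, ∀ m K n : ℕ, Nat.log 2 m ^ 2 ≤ K → SignedRow m K n → OctaveRootLawAt m K (2 ^ (C * K) * (n + 1))

/-- **RUNG (lens `wuc`) — bounded-aspect octave lifting**: one `C` for every aspect bound `A`, eventually in `K`. -/
def BoundedAspectOctaveLifting : Prop :=
  ∃ C : ℕ, ∀ A : ℕ, ∃ K₀ : ℕ, ∀ m K n : ℕ, K₀ ≤ K → m ≤ A * K → SignedRow m K n →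
    OctaveRootLawAt m K (2 ^ (C * K) * (n + 1))

/-- TRANSFER stub (load-bearing in `OctaveWeakLifting_of`, next to the route item `TropicalB`).  Why it might fail: exactly as Ω-W —
deep signed cancellation putting root scales far from every breakpoint — but now only at fat formats `m ≤ 2^√K`. -/
theorem stub_octaveFatLifting : OctaveFatLifting := by
  sorry

/-- RUNG stub (wuc; a consequence of the crux, `boundedAspectOctaveLifting_of_octaveWeakLifting`).  Why it might fail: a bounded-aspect
family `(A·K, K)`, `K → ∞`, whose pencils have `≥ 2^(C_A·K)·(T(A·K,K)+1)` root octaves with `C_A → ∞` — which refutes Ω-W. -/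
theorem stub_boundedAspectOctaveLifting : BoundedAspectOctaveLifting := by
  sorry

/-! ## 3. Class padding for the octave row -/

/-- appending ABSENT slope classes (zero coefficient matrices) does not change the pencil: the octave row is antitone in `K`. [folklore] -/
theorem octaveRootLawAt_of_le_classes {m K K' B : ℕ} (hK : K ≤ K') (h : OctaveRootLawAt m K' B) : OctaveRootLawAt m K B := by
  obtain ⟨t, rfl⟩ := Nat.exists_eq_add_of_le hK
  intro d S hS
  let d' : Fin (K + t) → ℕ := Fin.append d (fun _ => 0)
  let S' : Fin (K + t) → Matrix (Fin m) (Fin m) ℝ := Fin.append S (fun _ => 0)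
  have hS' : ∀ l, (S' l).IsSymm := by
    intro l
    refine Fin.addCases (motive := fun l => (S' l).IsSymm) (fun i => ?_) (fun j => ?_) l
    · simp only [S', Fin.append_left]; exact hS i
    · simp only [S', Fin.append_right]; exact Matrix.isSymm_zero
  have hsum : (∑ l, ((X : ℝ[X]) ^ d' l) • (S' l).map C) = ∑ l, ((X : ℝ[X]) ^ d l) • (S l).map C := by
    rw [Fin.sum_univ_add]
    have h2 : (∑ j : Fin t, ((X : ℝ[X]) ^ d' (Fin.natAdd K j)) • (S' (Fin.natAdd K j)).map C) = 0 := by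
      refine Finset.sum_eq_zero (fun j _ => ?_)
      simp only [S', Fin.append_right]
      rw [Matrix.map_zero _ (map_zero C), smul_zero]
    rw [h2, add_zero]
    refine Finset.sum_congr rfl (fun i _ => ?_)
    simp only [d', S', Fin.append_left]
  have h1 := h d' S' hS'
  rw [hsum] at h1
  exact h1

/-! ## 4. The composition: `TropicalB → OctaveFatLifting → OctaveWeakLifting` -/

/-- **COMPOSITION (kernel-checked, sorry-free).**  The route item `TropicalB` (stmt-19771) enters BY NAME; the transfer stub is the only
other hypothesis.  Constant: `C = C_F + 2·C_T + 1`. -/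
theorem OctaveWeakLifting_of (hT : TropicalB) (hF : OctaveFatLifting) : OctaveWeakLifting := by
  obtain ⟨CT, hT⟩ := tropicalB_iff.mp hT
  obtain ⟨CF, hF⟩ := hF
  refine ⟨CF + 2 * CT + 1, fun m K n hrow => ?_⟩
  set L := Nat.log 2 m with hL
  by_cases hfat : L ^ 2 ≤ K
  · refine octaveRootLawAt_mono (Nat.mul_le_mul_right (n + 1) (Nat.pow_le_pow_right two_pos ?_)) (hF m K n hfat hrow)
    nlinarith [Nat.zero_le (K + L ^ 2), Nat.zero_le CT]
  · have hKL : K ≤ L ^ 2 := by omega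
    have hL1 : 1 ≤ L ^ 2 := by omega
    have hrow' : SignedRow m (L ^ 2) (2 ^ (CT * (L ^ 2 + L ^ 2))) := hT m (L ^ 2)
    have h1 : OctaveRootLawAt m (L ^ 2) (2 ^ (CF * L ^ 2) * (2 ^ (CT * (L ^ 2 + L ^ 2)) + 1)) := hF m (L ^ 2) _ le_rfl hrow'
    have h2 : OctaveRootLawAt m K (2 ^ (CF * L ^ 2) * (2 ^ (CT * (L ^ 2 + L ^ 2)) + 1)) := octaveRootLawAt_of_le_classes hKL h1
    refine octaveRootLawAt_mono ?_ h2
    have h3 : 2 ^ (CT * (L ^ 2 + L ^ 2)) + 1 ≤ 2 ^ (CT * (L ^ 2 + L ^ 2) + 1) := by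
      have h := Nat.one_le_two_pow (n := CT * (L ^ 2 + L ^ 2))
      have h' : 2 ^ (CT * (L ^ 2 + L ^ 2) + 1) = 2 ^ (CT * (L ^ 2 + L ^ 2)) * 2 := Nat.pow_succ 2 _
      omega
    have h4 : CF * L ^ 2 + (CT * (L ^ 2 + L ^ 2) + 1) ≤ (CF + 2 * CT + 1) * (K + L ^ 2) := by nlinarith
    calc 2 ^ (CF * L ^ 2) * (2 ^ (CT * (L ^ 2 + L ^ 2)) + 1)
        ≤ 2 ^ (CF * L ^ 2) * 2 ^ (CT * (L ^ 2 + L ^ 2) + 1) := Nat.mul_le_mul_left _ h3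
      _ = 2 ^ (CF * L ^ 2 + (CT * (L ^ 2 + L ^ 2) + 1)) := (pow_add 2 _ _).symm
      _ ≤ 2 ^ ((CF + 2 * CT + 1) * (K + L ^ 2)) := Nat.pow_le_pow_right two_pos h4
      _ ≤ 2 ^ ((CF + 2 * CT + 1) * (K + L ^ 2)) * (n + 1) := Nat.le_mul_of_pos_right _ (Nat.succ_pos n)

/-! ## 5. Honesty: where the transfer and the rung sit -/

/-- Ω-W ⇒ the fat law (trivial direction: `2^(C(K+L²)) ≤ 2^(2C·K)` on fat formats). -/
theorem octaveFatLifting_of_octaveWeakLifting (h : OctaveWeakLifting) : OctaveFatLifting := by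
  obtain ⟨C, hC⟩ := octaveWeakLifting_iff.mp h
  refine ⟨2 * C, fun m K n hfat hrow => octaveRootLawAt_mono (Nat.mul_le_mul_right (n + 1) (Nat.pow_le_pow_right two_pos ?_)) (hC m K n hrow)⟩
  nlinarith

/-- **REGIME COLLAPSE MODULO THE SIBLING CRUX**: given `TropicalB`, Ω-W is equivalent to its fat regime. -/
theorem octaveFatLifting_iff_octaveWeakLifting_of_tropicalB (hT : TropicalB) : OctaveFatLifting ↔ OctaveWeakLifting :=
  ⟨fun hF => OctaveWeakLifting_of hT hF, octaveFatLifting_of_octaveWeakLifting⟩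

/-- `⌊log₂(A·K)⌋² ≤ K` once `K ≥ 4^(max (⌊log₂A⌋+2) 8)`. [folklore] (same lemma as in `Cruxes/TropicalB/Lines/aspect_decay.lean`) -/
theorem log_sq_mul_le {A K : ℕ} (hK : 4 ^ max (Nat.log 2 A + 2) 8 ≤ K) : Nat.log 2 (A * K) ^ 2 ≤ K := by
  have h0 := PolyTowers.sq_log_succ_le_self (Nat.log 2 A + 2) K hK
  have hlog : Nat.log 2 (A * K) ≤ Nat.log 2 A + Nat.log 2 K + 1 := by
    rcases Nat.eq_zero_or_pos (A * K) with hz | hpos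
    · rw [hz, Nat.log_zero_right]; omega
    have hA : A < 2 ^ (Nat.log 2 A + 1) := Nat.lt_pow_succ_log_self one_lt_two A
    have hK' : K < 2 ^ (Nat.log 2 K + 1) := Nat.lt_pow_succ_log_self one_lt_two K
    have hAK : A * K < 2 ^ (Nat.log 2 A + Nat.log 2 K + 2) := by
      calc A * K < 2 ^ (Nat.log 2 A + 1) * 2 ^ (Nat.log 2 K + 1) := Nat.mul_lt_mul'' hA hK'
        _ = 2 ^ (Nat.log 2 A + Nat.log 2 K + 2) := by rw [← pow_add]; ring_nf
    have := Nat.log_lt_of_lt_pow hpos.ne' hAK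
    omega
  have h1 : Nat.log 2 A + Nat.log 2 K + 1 ≤ (Nat.log 2 A + 2) * (Nat.log 2 K + 1) := by nlinarith
  calc Nat.log 2 (A * K) ^ 2 ≤ (Nat.log 2 A + Nat.log 2 K + 1) ^ 2 := Nat.pow_le_pow_left hlog 2
    _ ≤ ((Nat.log 2 A + 2) * (Nat.log 2 K + 1)) ^ 2 := Nat.pow_le_pow_left h1 2
    _ = (Nat.log 2 A + 2) ^ 2 * (Nat.log 2 K + 1) ^ 2 := by ring
    _ ≤ K := h0

/-- the rung from the FAT law, onset `K₀(A) = 4^(max (⌊log₂A⌋+2) 8)`: a format `m ≤ A·K` with `K ≥ K₀(A)` is fat. -/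
theorem boundedAspectOctaveLifting_of_octaveFatLifting (h : OctaveFatLifting) : BoundedAspectOctaveLifting := by
  obtain ⟨C, hC⟩ := h
  refine ⟨C, fun A => ⟨4 ^ max (Nat.log 2 A + 2) 8, fun m K n hK hm hrow => hC m K n ?_ hrow⟩⟩
  calc Nat.log 2 m ^ 2 ≤ Nat.log 2 (A * K) ^ 2 := Nat.pow_le_pow_left (Nat.log_mono_right hm) 2
    _ ≤ K := log_sq_mul_le hK

/-- HONESTY: the rung is a CONSEQUENCE of the crux. -/
theorem boundedAspectOctaveLifting_of_octaveWeakLifting (h : OctaveWeakLifting) : BoundedAspectOctaveLifting :=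
  boundedAspectOctaveLifting_of_octaveFatLifting (octaveFatLifting_of_octaveWeakLifting h)

/-- KILL PATH: a refutation of the rung refutes the crux (and with it the route `KPlusLogSqLawOctave`). -/
theorem not_octaveWeakLifting_of_not_boundedAspectOctaveLifting (h : ¬ BoundedAspectOctaveLifting) : ¬ OctaveWeakLifting :=
  fun hΩ => h (boundedAspectOctaveLifting_of_octaveWeakLifting hΩ)

/-! ## 6. Base: the rung at each FIXED aspect is Descartes (inside the known regime — calibration, not content) -/

/-- the octave row is below the real row. [folklore] -/
theorem octaveRootLawAt_of_realRootLawAt {m K B : ℕ} (h : RealRootLawAt m K B) : OctaveRootLawAt m K B :=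
  fun d S hS => (octaveCount_le_card _).trans (h d S hS)

/-- **FIXED-ASPECT BASE (Descartes).**  For each dyadic aspect bound `2^c` the rung's inequality holds with a constant
`C_c = 2·(2^c+1)` DEPENDING ON `c` (from `realRootLawAt_fatCone`: `ζ ≤ 2^((2^c+1)(K+L²))`, and `L² ≤ K` past the onset), with no
tropical input at all — so the rung's whole content is the UNIFORMITY of `C` in the aspect, exactly as for its tropical twin
`BoundedAspectRate` vs `DoublingQuasi.tropRootLawAt_fatCone`. -/
theorem boundedAspectOctaveLifting_fixedAspect (c : ℕ) :
    ∃ C K₀ : ℕ, ∀ m K n : ℕ, K₀ ≤ K → m ≤ 2 ^ c * K → SignedRow m K n → OctaveRootLawAt m K (2 ^ (C * K) * (n + 1)) := by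
  refine ⟨2 * (2 ^ c + 1), 4 ^ max (Nat.log 2 (2 ^ c) + 2) 8, fun m K n hK hm _ => ?_⟩
  have hL : Nat.log 2 m ^ 2 ≤ K :=
    (Nat.pow_le_pow_left (Nat.log_mono_right hm) 2).trans (log_sq_mul_le hK)
  refine octaveRootLawAt_mono ?_ (octaveRootLawAt_of_realRootLawAt (realRootLawAt_fatCone c m K hm))
  calc 2 ^ ((2 ^ c + 1) * (K + Nat.log 2 m ^ 2)) ≤ 2 ^ (2 * (2 ^ c + 1) * K) :=
        Nat.pow_le_pow_right two_pos (by nlinarith [Nat.zero_le (2 ^ c)])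
    _ ≤ 2 ^ (2 * (2 ^ c + 1) * K) * (n + 1) := Nat.le_mul_of_pos_right _ (Nat.succ_pos n)

end Summit.ValiantsHypothesis.ValiantsHypothesis.Cruxes.OctaveWeakLifting.OctaveAspect
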